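import Summits.CriticalPhenomena.PercolationContinuityZ3.Theorems.Transplant.SharpnessRayDuality
import Literature.Probability.Percolation.HalfPlaneUCatch
import Literature.Probability.Percolation.HalfPlaneArmAxisInputs
import Literature.Probability.Percolation.Z2HalfPlaneTwoArm
import HarnessLib

/-!
# Transplant sharpness LXIV — the blocking circuit of the reinforced ray: arms caught by a U, a tall crossing, a bridge
# and the mirror image give a dual top–bottom crossing of the right rectangle (deterministic)

builds on p205010 (kernel theorem, internal audit signed; external expert review pending).
Status sentence (coordinator 2026-08-20T04:30Z): "θ(p_c) = 0 on ℤ^d, all d ≥ 2 — kernel-verified (Lean 4/Mathlib,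
standard axioms); internal adversarial audit SIGNED 2026-08-20 04:29Z; external expert review pending."

Lane `prim-bschramm`, seat p5 (sharpness); memo `run/shared/lean/prim/bschramm/P5-SHARPNESS.md` §48, row 85 (kernel
programme "RAY"; plan `run/shared/lean/prim/bschramm/prim-bschramm-p5-g22/RAY-PLAN.md` §3, module L6).

Scale `t ≥ 1`, annulus scale `n = 16t` (right rectangle `R_n = [16t,48t] × [−48t,48t]` of Harris' scheme, whose dual
rectangle is `{16t ≤ a ≤ 48t−1, −48t−1 ≤ b ≤ 48t}` in the lower-left-corner indexing of faces). For a dual configuration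
`η` (faces `(a,b)`, upper half `b ≥ 0`, lower half `b ≤ −1`, exchanged by the face reflection `Φ(a,b) = (a,−1−b)`,
which is `reflY (-1)`), and an abscissa `32t ≤ x < 33t` of the window:

* `SU[t]` (local notation) — Nolin's U (`HalfPlaneArm.uCatch`: two pillars and a bar, base `(32t,0)`, size `2t`) together
  with a tall top–bottom crossing of `[28t,36t] × [2t,48t]`; `OA[x, 8t]` — the window arm of LVIII from `(x,0)` to
  sup-distance `8t`;
* `upper_path` — on `SU[t] ∩ OA[x,8t]` the face `(x,0)` is joined inside the upper part of the dual rectangle to its top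
  row `b = 48t` (U-catch, then the planar crossing lemma `HalfPlaneArm.meet` for the bar and the tall crossing);
* `lower_path` — the mirror statement for `Φη`, transported back by `Φ`;
* `dual_tb_crossing` — with the bridge `{(x,−1),(x,0)}` open as well, `η` crosses the dual rectangle from top to bottom;
* `not_rightShortCrossing` — hence (LXIII `not_openCrossing_of_dual_tb`) the lattice configuration has no open
  left–right crossing of `R_n`; `annulusBlocked_of_structure` — with the three other rectangles, `annulusBlocked (16t)`.
-/

noncomputable section

namespace Summit.CriticalPhenomena.PercolationContinuityZ3.Theorems.TransplantSharpness

namespace Ray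

open Literature.Probability.Percolation Literature.Probability.LatticeModels
open Literature.Probability.Percolation.Z2HalfPlane (Far siteBox mem_siteBox)
open MeasureTheory Filter Set SimpleGraph

local notation3 "box[" A₁ ", " A₂ ", " B₁ ", " B₂ "]" =>
  {v : Site 2 | (A₁ : ℤ) ≤ v 0 ∧ v 0 ≤ (A₂ : ℤ) ∧ (B₁ : ℤ) ≤ v 1 ∧ v 1 ≤ (B₂ : ℤ)}
local notation3 "LR[" A₁ ", " A₂ ", " B₁ ", " B₂ "]" =>
  openCrossing box[A₁, A₂, B₁, B₂] {v : Site 2 | v 0 = (A₁ : ℤ)} {v : Site 2 | v 0 = (A₂ : ℤ)}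
local notation3 "TB[" A₁ ", " A₂ ", " B₁ ", " B₂ "]" =>
  openCrossing box[A₁, A₂, B₁, B₂] {v : Site 2 | v 1 = (B₁ : ℤ)} {v : Site 2 | v 1 = (B₂ : ℤ)}
/-- The window arm of LVIII: an open path from `(a,0)` inside `[a-R,a+R]×[0,R]` to sup-distance `R`. -/
local notation3 "OA[" a ", " R "]" =>
  {ω : BondConfig (Site 2) | ∃ v : Site 2, Far R a v ∧ ω ∈ openConnIn ↑(siteBox a R) ![a, 0] v}
/-- The upper structure at scale `t`: Nolin's U with base `(32t,0)` and size `2t` (written in the shape produced by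
`HalfPlaneArm.uCatch` for the axis coordinates), and a tall top–bottom crossing of `[28t,36t]×[2t,48t]`. -/
local notation3 "SU[" t "]" =>
  ((TB[(32 : ℤ) * t + 2 * t, (32 : ℤ) * t + 2 * (2 * t), (0 : ℤ), (0 : ℤ) + 2 * (2 * t)] ∩
    LR[(32 : ℤ) * t - 2 * (2 * t), (32 : ℤ) * t + 2 * (2 * t), (0 : ℤ) + 2 * t, (0 : ℤ) + 2 * (2 * t)] ∩
    TB[(32 : ℤ) * t - 2 * (2 * t), (32 : ℤ) * t - 2 * t, (0 : ℤ), (0 : ℤ) + 2 * (2 * t)]) ∩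
    TB[(28 : ℤ) * t, (28 : ℤ) * t + 8 * t, (2 : ℤ) * t, (2 : ℤ) * t + 46 * t])
/-- The face reflection `Φ(a,b) = (a,-1-b)` acting on dual configurations. -/
local notation3 "refl[" ω "]" => BondConfig.relabel (sym2Equiv (reflY (-1)).toEquiv) (ω : BondConfig (Site 2))
/-- The upper part of the dual rectangle of `R_{16t}`. -/
local notation3 "Dup[" t "]" => box[(16 : ℤ) * t, (48 : ℤ) * t - 1, (0 : ℤ), (48 : ℤ) * t]
/-- The dual rectangle of `R_{16t}`. -/
local notation3 "Dall[" t "]" => box[(16 : ℤ) * t, (48 : ℤ) * t - 1, -((48 : ℤ) * t) - 1, (48 : ℤ) * t]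

/-! ### The upper path -/

/-- **The upper path.** On `SU[t] ∩ OA[x, 8t]` (`32t ≤ x < 33t`) the face `(x,0)` is joined by an `η`-open path inside
`{16t ≤ a ≤ 48t−1, 0 ≤ b ≤ 48t}` to a face of the row `b = 48t`.
[cite: Nolin2008, §4.3, proof of Prop. 12 (i) (arXiv 0711.4948: Prop. 11), with §4.6] -/
theorem upper_path {t : ℕ} (ht : 1 ≤ t) {η : BondConfig (Site 2)} (hη : η ⊆ (zdGraph 2).edgeSet) {x : ℤ}
    (hx : 32 * (t : ℤ) ≤ x) (hx' : x < 33 * t) (hU : η ∈ SU[t]) (hA : η ∈ OA[x, 8 * t]) :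
    ∃ y : Site 2, y 1 = 48 * t ∧ η ∈ openConnIn Dup[t] ![x, 0] y := by
  have hs2 : (0 : ℝ) < Real.sqrt 2 := by positivity
  obtain ⟨⟨⟨⟨xR, hxR, yR, hyR, hR⟩, ⟨xB, hxB, yB, hyB, hBar⟩⟩, ⟨xL, hxL, yL, hyL, hL⟩⟩, ⟨xT, hxT, yT, hyT, hTall⟩⟩ := hU
  obtain ⟨v, hfar, hconn⟩ := hA
  -- the U catches the arm
  have hcatch := HalfPlaneArm.uCatch (X := fun v : Site 2 => v 0) (Y := fun v : Site 2 => v 1)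
    HalfPlaneArm.axis_X_le HalfPlaneArm.axis_Y_le (emb := squareLatticeEmbedding) isIsoradial_squareLatticeEmbedding_holds
    isRhombicTiling_squareLatticeEmbedding_holds (κ := Real.sqrt 2) hs2 HalfPlaneArm.axis_re HalfPlaneArm.axis_im hη
    (b := ![32 * (t : ℤ), 0]) (by simp) (a := 2 * (t : ℤ)) (by omega) hBar hxB hyB hR hxR hyR hL hxL hyL
    (S := (↑(siteBox x (8 * t)) : Set (Site 2))) (fun w hw => (mem_siteBox.1 hw).2.1) hconn
    (by
      simp only [Matrix.cons_val_zero, Matrix.cons_val_one, sub_zero, max_le_iff, abs_le]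
      omega)
    (by
      simp only [Matrix.cons_val_zero, Matrix.cons_val_one, sub_zero, le_max_iff, le_abs]
      rcases hfar with h | h
      · left
        rcases le_abs.1 h with h' | h'
        · left; push_cast at h'; omega
        · right; push_cast at h'; omega
      · right; push_cast at h; omega)
  -- the tall crossing meets the bar
  have hmeet := HalfPlaneArm.meet (X := fun v : Site 2 => v 0) (Y := fun v : Site 2 => v 1)
    (emb := squareLatticeEmbedding) isIsoradial_squareLatticeEmbedding_holds
    isRhombicTiling_squareLatticeEmbedding_holds (κ := Real.sqrt 2) hs2 HalfPlaneArm.axis_re HalfPlaneArm.axis_im hη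
    (S := box[(32 : ℤ) * t - 2 * (2 * t), (32 : ℤ) * t + 2 * (2 * t), (0 : ℤ) + 2 * t, (0 : ℤ) + 2 * (2 * t)])
    (A := {xB}) (B := {yB})
    (S' := box[(28 : ℤ) * t, (28 : ℤ) * t + 8 * t, (2 : ℤ) * t, (2 : ℤ) * t + 46 * t])
    (A' := {v : Site 2 | v 1 = (2 : ℤ) * t}) (B' := {v : Site 2 | v 1 = (2 : ℤ) * t + 46 * t})
    (a₁ := (32 : ℤ) * t - 2 * (2 * t)) (a₂ := (32 : ℤ) * t + 2 * (2 * t)) (c₁ := (0 : ℤ) + 2 * t)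
    (c₂ := (0 : ℤ) + 2 * (2 * t)) (by omega) (by omega)
    (fun w hw => ⟨hw.2.2.1, hw.2.2.2⟩) (fun w hw => by rw [Set.mem_singleton_iff.1 hw]; exact hxB.le)
    (fun w hw => by rw [Set.mem_singleton_iff.1 hw]; exact hyB.ge)
    (fun w hw => ⟨by have := hw.1; omega, by have := hw.2.1; omega⟩) (fun w hw => by have : w 1 = _ := hw; omega)
    (fun w hw => by have : w 1 = _ := hw; omega)
    ⟨xB, rfl, yB, rfl, hBar⟩ ⟨xT, hxT, yT, hyT, hTall⟩
  obtain ⟨w, -, -, ⟨x', hx', hBw⟩, -, -, ⟨y', hy', hTw⟩⟩ := hmeet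
  rw [Set.mem_singleton_iff] at hx'
  subst hx'
  refine ⟨y', by have : y' 1 = _ := hy'; omega, ?_⟩
  -- containments in the upper part of the dual rectangle
  have hS : (↑(siteBox x (8 * t)) : Set (Site 2)) ∪
      box[(![32 * (t : ℤ), 0] : Site 2) 0 - 2 * (2 * (t : ℤ)), (![32 * (t : ℤ), 0] : Site 2) 0 + 2 * (2 * (t : ℤ)), (0 : ℤ),
        (![32 * (t : ℤ), 0] : Site 2) 1 + 2 * (2 * (t : ℤ))] ⊆ Dup[t] := by
    rintro z (hz | hz)
    · have h := mem_siteBox.1 hz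
      refine ⟨?_, ?_, h.2.1, ?_⟩ <;> push_cast at h <;> omega
    · simp only [mem_setOf_eq, Matrix.cons_val_zero, Matrix.cons_val_one] at hz
      refine ⟨?_, ?_, hz.2.2.1, ?_⟩ <;> omega
  have hB : box[(32 : ℤ) * t - 2 * (2 * t), (32 : ℤ) * t + 2 * (2 * t), (0 : ℤ) + 2 * t, (0 : ℤ) + 2 * (2 * t)] ⊆ Dup[t] := by
    intro z hz; exact ⟨by have := hz.1; omega, by have := hz.2.1; omega, by have := hz.2.2.1; omega,
      by have := hz.2.2.2; omega⟩
  have hT : box[(28 : ℤ) * t, (28 : ℤ) * t + 8 * t, (2 : ℤ) * t, (2 : ℤ) * t + 46 * t] ⊆ Dup[t] := by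
    intro z hz; exact ⟨by have := hz.1; omega, by have := hz.2.1; omega, by have := hz.2.2.1; omega,
      by have := hz.2.2.2; omega⟩
  exact PlanarDuality.openConnIn_trans (PlanarDuality.openConnIn_trans (openConnIn_mono hS _ _ hcatch)
    (openConnIn_mono hB _ _ hBw)) (openConnIn_mono hT _ _ hTw)

/-! ### The lower path, by reflection -/

/-- `Φ` is an involution on pairs. [folklore] -/
theorem relabel_refl_relabel_refl (ω : BondConfig (Site 2)) : refl[refl[ω]] = ω := by
  rw [BondConfig.relabel_apply, BondConfig.relabel_apply, Set.image_image]
  have hid : (fun z => sym2Equiv (reflY (-1)).toEquiv (sym2Equiv (reflY (-1)).toEquiv z)) = id := by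
    funext z
    induction z using Sym2.ind with
    | h a b => simp [RelIso.coe_fn_toEquiv]
  rw [hid, Set.image_id]

/-- `Φ` preserves lattice configurations. [folklore] -/
theorem refl_subset_edgeSet {ω : BondConfig (Site 2)} (hω : ω ⊆ (zdGraph 2).edgeSet) :
    refl[ω] ⊆ (zdGraph 2).edgeSet := by
  intro z hz
  rw [BondConfig.relabel_apply] at hz
  obtain ⟨e, he, rfl⟩ := hz
  exact (sym2Equiv_mem_edgeSet_iff (reflY (-1)) e).2 (hω he)

/-- **The lower path**: if the reflected configuration `Φη` lies in `SU[t] ∩ OA[x, 8t]`, the face `(x,−1)` is joined by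
an `η`-open path inside `{16t ≤ a ≤ 48t−1, −48t−1 ≤ b ≤ −1}` to a face of the row `b = −48t−1`. [folklore] -/
theorem lower_path {t : ℕ} (ht : 1 ≤ t) {η : BondConfig (Site 2)} (hη : η ⊆ (zdGraph 2).edgeSet) {x : ℤ}
    (hx : 32 * (t : ℤ) ≤ x) (hx' : x < 33 * t) (hU : refl[η] ∈ SU[t]) (hA : refl[η] ∈ OA[x, 8 * t]) :
    ∃ y : Site 2, y 1 = -(48 * t) - 1 ∧ η ∈ openConnIn Dall[t] ![x, -1] y := by
  obtain ⟨y, hy, hconn⟩ := upper_path ht (refl_subset_edgeSet hη) hx hx' hU hA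
  have h := relabel_mem_openConnIn (reflY (-1)).toEquiv hconn
  rw [relabel_refl_relabel_refl] at h
  have hpt : (reflY (-1)).toEquiv ![x, 0] = ![x, -1] := by
    rw [RelIso.coe_fn_toEquiv]; ext i; fin_cases i <;> simp
  have hsub : (reflY (-1)).toEquiv '' Dup[t] ⊆ Dall[t] := by
    rintro z ⟨w, hw, rfl⟩
    simp only [mem_setOf_eq, RelIso.coe_fn_toEquiv, reflY_apply_zero, reflY_apply_one] at hw ⊢
    omega
  rw [hpt] at h
  refine ⟨(reflY (-1)).toEquiv y, ?_, openConnIn_mono hsub _ _ h⟩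
  rw [RelIso.coe_fn_toEquiv, reflY_apply_one, hy]; ring

/-! ### The dual top–bottom crossing and the blocked annulus -/

/-- **The dual top–bottom crossing of the right rectangle.** On `SU[t] ∩ OA[x,8t]`, the mirror event for `Φη`, and
the bridge `{(x,−1),(x,0)} ∈ η`, the dual configuration `η` crosses the dual rectangle of `R_{16t} = [16t,48t]×[−48t,48t]`
from its top row to its bottom row. [cite: Zhang1994, Thm. 1 (the line version)] -/
theorem dual_tb_crossing {t : ℕ} (ht : 1 ≤ t) {η : BondConfig (Site 2)} (hη : η ⊆ (zdGraph 2).edgeSet) {x : ℤ}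
    (hx : 32 * (t : ℤ) ≤ x) (hx' : x < 33 * t) (hU : η ∈ SU[t]) (hA : η ∈ OA[x, 8 * t]) (hU' : refl[η] ∈ SU[t])
    (hA' : refl[η] ∈ OA[x, 8 * t]) (hb : (s(![x, -1], ![x, 0]) : Sym2 (Site 2)) ∈ η) :
    η ∈ openCrossing ((· + rightCorner (16 * t)) '' (↑(dualRectangle (2 * (16 * t)) (6 * (16 * t))) : Set (Site 2)))
      ((· + rightCorner (16 * t)) '' (↑(dualTopSide (2 * (16 * t)) (6 * (16 * t))) : Set (Site 2)))
      ((· + rightCorner (16 * t)) '' (↑(dualBottomSide (2 * (16 * t)) (6 * (16 * t))) : Set (Site 2))) := by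
  obtain ⟨y, hy, hup⟩ := upper_path ht hη hx hx' hU hA
  obtain ⟨y', hy', hlow⟩ := lower_path ht hη hx hx' hU' hA'
  have hyD : y ∈ Dup[t] := by obtain ⟨-, h, -⟩ := hup; exact h
  have hy'D : y' ∈ Dall[t] := by obtain ⟨-, h, -⟩ := hlow; exact h
  have hDup : Dup[t] ⊆ Dall[t] := fun z hz => ⟨hz.1, hz.2.1, by have := hz.2.2.1; omega, hz.2.2.2⟩
  have hDall : Dall[t] ⊆ (· + rightCorner (16 * t)) '' (↑(dualRectangle (2 * (16 * t)) (6 * (16 * t))) : Set (Site 2)) := by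
    intro z hz
    refine ⟨z - rightCorner (16 * t), ?_, by simp⟩
    rw [Finset.mem_coe, mem_dualRectangle_iff]
    simp only [Pi.sub_apply, rightCorner_apply_zero, rightCorner_apply_one]
    obtain ⟨h1, h2, h3, h4⟩ := hz
    push_cast
    refine ⟨by omega, by omega, by omega, by omega⟩
  -- the bridge joins `(x,0)` to `(x,-1)`
  have hbridge : η ∈ openConnIn Dall[t] ![x, 0] ![x, -1] := by
    refine openConnIn_of_adj ?_ ?_ (by rwa [Sym2.eq_swap]) ?_
    · simp only [mem_setOf_eq, Matrix.cons_val_zero, Matrix.cons_val_one]; omega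
    · simp only [mem_setOf_eq, Matrix.cons_val_zero, Matrix.cons_val_one]; omega
    · intro h; have := congrFun h 1; simp at this
  have hpath : η ∈ openConnIn Dall[t] y y' := by
    have h1 : η ∈ openConnIn Dall[t] y ![x, 0] := by
      rw [openConnIn_comm]; exact openConnIn_mono hDup _ _ hup
    exact PlanarDuality.openConnIn_trans (PlanarDuality.openConnIn_trans h1 hbridge) hlow
  refine ⟨y, ?_, y', ?_, openConnIn_mono hDall _ _ hpath⟩
  · refine ⟨y - rightCorner (16 * t), ?_, by simp⟩
    rw [Finset.mem_coe, dualTopSide, Finset.mem_filter, mem_dualRectangle_iff]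
    simp only [Pi.sub_apply, rightCorner_apply_zero, rightCorner_apply_one]
    obtain ⟨h1, h2, h3, h4⟩ := hyD
    push_cast
    refine ⟨⟨by omega, by omega, by omega, by omega⟩, by omega⟩
  · refine ⟨y' - rightCorner (16 * t), ?_, by simp⟩
    rw [Finset.mem_coe, dualBottomSide, Finset.mem_filter, mem_dualRectangle_iff]
    simp only [Pi.sub_apply, rightCorner_apply_zero, rightCorner_apply_one]
    obtain ⟨h1, h2, h3, h4⟩ := hy'D
    push_cast
    refine ⟨⟨by omega, by omega, by omega, by omega⟩, by omega⟩

/-- **No open left–right crossing of the right rectangle.** For a lattice configuration `ω̃` whose dual configuration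
`η = dualConfig ω̃` carries the structure of `dual_tb_crossing`, `ω̃ ∉ rightShortCrossing (16t)`.
[cite: BollobasRiordan2006, Ch. 3, Lemma 1] -/
theorem not_rightShortCrossing {t : ℕ} (ht : 1 ≤ t) {ω : BondConfig (Site 2)} (hω : ω ⊆ (zdGraph 2).edgeSet)
    {x : ℤ} (hx : 32 * (t : ℤ) ≤ x) (hx' : x < 33 * t) (hU : dualConfig ω ∈ SU[t]) (hA : dualConfig ω ∈ OA[x, 8 * t])
    (hU' : refl[dualConfig ω] ∈ SU[t]) (hA' : refl[dualConfig ω] ∈ OA[x, 8 * t])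
    (hb : (s(![x, -1], ![x, 0]) : Sym2 (Site 2)) ∈ dualConfig ω) :
    ω ∉ rightShortCrossing (16 * t) :=
  not_openCrossing_of_dual_tb hω (rightCorner (16 * t)) (2 * (16 * t)) (6 * (16 * t))
    (dual_tb_crossing ht (fun _ he => (mem_dualConfig_iff.1 he).1) hx hx' hU hA hU' hA' hb)

/-- **The blocked annulus from the structure**: no short-way crossing of the top, bottom and left rectangles, plus
the structure of `dual_tb_crossing` in the dual configuration, give `annulusBlocked (16t)` (Harris' event `E_k`).
[cite: BollobasRiordan2006, Ch. 3, proof of Thm. 6 (event E_k)] -/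
theorem annulusBlocked_of_structure {t : ℕ} (ht : 1 ≤ t) {ω : BondConfig (Site 2)} (hω : ω ⊆ (zdGraph 2).edgeSet)
    (hT : ω ∉ topShortCrossing (16 * t)) (hB : ω ∉ bottomShortCrossing (16 * t)) (hL : ω ∉ leftShortCrossing (16 * t))
    {x : ℤ} (hx : 32 * (t : ℤ) ≤ x) (hx' : x < 33 * t) (hU : dualConfig ω ∈ SU[t]) (hA : dualConfig ω ∈ OA[x, 8 * t])
    (hU' : refl[dualConfig ω] ∈ SU[t]) (hA' : refl[dualConfig ω] ∈ OA[x, 8 * t])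
    (hb : (s(![x, -1], ![x, 0]) : Sym2 (Site 2)) ∈ dualConfig ω) :
    ω ∈ annulusBlocked (16 * t) :=
  ⟨⟨⟨hT, hB⟩, hL⟩, not_rightShortCrossing ht hω hx hx' hU hA hU' hA' hb⟩

end Ray

end Summit.CriticalPhenomena.PercolationContinuityZ3.Theorems.TransplantSharpness
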